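import Mathlib
import Summits.Ventures.HodgeRepro2.LevelUnitsKroneckerCM

/-!
# `E¹ ∩ ∏_v O_{E_v}^× = μ(E)`: the adelic-to-global reading of T4-B5 Remark B5.9

Blind cell `pub-hodge-repro2`, seat p8 (gen 8), Tier-4 B5 / Tier-5 kernel support.  Remark B5.9 of
route/T4-B5-p8.md shows that the compact open subgroup `U = ∏_{v<∞} O_{E_v}^1` of `(A_E^∞)^1` meets
`E^1` in the finite group of roots of unity of `E`: «an element `u ∈ E^1` with `u ∈ O_{E_v}^1` for
all finite `v` lies in `O_E`, as does `ū = u⁻¹`, so `u` is a unit of `O_E` with `|σ(u)| = 1` at every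
embedding, hence a root of unity by Kronecker's theorem».  `LevelUnitsKronecker` (file 8) and
`LevelUnitsKroneckerCM` (B5-10) record the Kronecker step for an ALGEBRAIC INTEGER `u` of a CM
field with `u ū = 1`; what stayed prose was the first clause — that `u`, integral at every finite
place, is an algebraic integer.  This file records that clause from Mathlib:

* `isIntegral_iff_forall_valuation_le_one` — `x ∈ E` is an algebraic integer iff `v(x) ≤ 1` at every
  finite place `v` (Mathlib's `IsDedekindDomain.HeightOneSpectrum.mem_integers_of_valuation_le_one`
  for `𝓞 E`), and its adelic reading `isIntegral_iff_forall_mem_adicCompletionIntegers`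
  (`x ∈ O_{E_v}` inside the completion `E_v` for every `v`);
* `exists_pow_eq_one_of_forall_valuation_le_one` / `…_of_forall_mem_adicCompletionIntegers` — for
  `E` a CM field, `x ∈ E` with `x x̄ = 1` and `x` integral at every finite place is a root of unity
  (B5-10's `exists_pow_eq_one_of_mul_complexConj_eq_one` with its integrality hypothesis discharged);
* `exists_mem_torsion_eq` — such an `x` is (the image of) an element of Mathlib's torsion subgroup
  `NumberField.Units.torsion E` of `(𝓞 E)ˣ`;
* `finite_setOf_mul_complexConj_eq_one` — the set `E¹ ∩ ∏_v O_{E_v}` is finite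
  (Mathlib's `NumberField.Embeddings.finite_of_norm_le`).

Nothing in this file touches the frozen text of T4-B5-p8.md v9; it discharges, from Mathlib, the
clause that v9's citation map listed as «supplied by the prose».

README §8(d): uses an L-value-free non-vanishing device: NO.
-/

namespace Summit.Ventures.HodgeRepro2.LevelUnitsAdelicIntegral

open IsDedekindDomain IsDedekindDomain.HeightOneSpectrum NumberField

variable {E : Type*} [Field E] [NumberField E]

/-- An element of a number field that is integral at every finite place is an algebraic integer. -/
theorem isIntegral_of_forall_valuation_le_one (x : E)
    (h : ∀ v : HeightOneSpectrum (𝓞 E), v.valuation E x ≤ 1) : IsIntegral ℤ x := by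
  obtain ⟨y, hy⟩ := mem_integers_of_valuation_le_one E x h
  rw [← hy]
  exact RingOfIntegers.isIntegral_coe y

/-- An algebraic integer is integral at every finite place. -/
theorem valuation_le_one_of_isIntegral {x : E} (hx : IsIntegral ℤ x)
    (v : HeightOneSpectrum (𝓞 E)) : v.valuation E x ≤ 1 := by
  obtain ⟨y, rfl⟩ := IsIntegralClosure.isIntegral_iff (A := 𝓞 E).mp hx
  exact valuation_le_one v y

/-- `x ∈ E` is an algebraic integer iff `v(x) ≤ 1` at every finite place `v`. -/
theorem isIntegral_iff_forall_valuation_le_one (x : E) :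
    IsIntegral ℤ x ↔ ∀ v : HeightOneSpectrum (𝓞 E), v.valuation E x ≤ 1 :=
  ⟨fun hx v => valuation_le_one_of_isIntegral hx v, isIntegral_of_forall_valuation_le_one x⟩

/-- THE ADELIC READING: `x ∈ E` lying in the integers `O_{E_v}` of every completion `E_v` is an
algebraic integer. -/
theorem isIntegral_of_forall_mem_adicCompletionIntegers (x : E)
    (h : ∀ v : HeightOneSpectrum (𝓞 E), (x : v.adicCompletion E) ∈ v.adicCompletionIntegers E) :
    IsIntegral ℤ x := by
  apply isIntegral_of_forall_valuation_le_one
  intro v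
  have := (mem_adicCompletionIntegers (𝓞 E) E v).mp (h v)
  rwa [valuedAdicCompletion_eq_valuation'] at this

/-- An algebraic integer lies in the integers of every completion. -/
theorem mem_adicCompletionIntegers_of_isIntegral {x : E} (hx : IsIntegral ℤ x)
    (v : HeightOneSpectrum (𝓞 E)) : (x : v.adicCompletion E) ∈ v.adicCompletionIntegers E := by
  rw [mem_adicCompletionIntegers, valuedAdicCompletion_eq_valuation']
  exact valuation_le_one_of_isIntegral hx v

/-- `x ∈ E` is an algebraic integer iff it lies in `O_{E_v}` for every finite place `v`. -/
theorem isIntegral_iff_forall_mem_adicCompletionIntegers (x : E) :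
    IsIntegral ℤ x ↔
      ∀ v : HeightOneSpectrum (𝓞 E), (x : v.adicCompletion E) ∈ v.adicCompletionIntegers E :=
  ⟨fun hx v => mem_adicCompletionIntegers_of_isIntegral hx v,
    isIntegral_of_forall_mem_adicCompletionIntegers x⟩

section CM

variable [IsCMField E]

/-- REMARK B5.9, KRONECKER STEP, ADELIC-TO-GLOBAL: for a CM field `E`, an element `x` with `x x̄ = 1`
that is integral at every finite place is a root of unity. -/
theorem exists_pow_eq_one_of_forall_valuation_le_one {x : E}
    (hx : ∀ v : HeightOneSpectrum (𝓞 E), v.valuation E x ≤ 1)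
    (h : x * IsCMField.complexConj E x = 1) : ∃ n : ℕ, 0 < n ∧ x ^ n = 1 :=
  LevelUnitsKroneckerCM.exists_pow_eq_one_of_mul_complexConj_eq_one
    (isIntegral_of_forall_valuation_le_one x hx) h

/-- The same with the adelic hypothesis `x ∈ O_{E_v}` for every finite `v`. -/
theorem exists_pow_eq_one_of_forall_mem_adicCompletionIntegers {x : E}
    (hx : ∀ v : HeightOneSpectrum (𝓞 E), (x : v.adicCompletion E) ∈ v.adicCompletionIntegers E)
    (h : x * IsCMField.complexConj E x = 1) : ∃ n : ℕ, 0 < n ∧ x ^ n = 1 :=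
  LevelUnitsKroneckerCM.exists_pow_eq_one_of_mul_complexConj_eq_one
    (isIntegral_of_forall_mem_adicCompletionIntegers x hx) h

/-- Such an `x` is a unit of `𝓞 E` of finite order: it comes from Mathlib's torsion subgroup
`NumberField.Units.torsion E`. -/
theorem exists_mem_torsion_eq {x : E}
    (hx : ∀ v : HeightOneSpectrum (𝓞 E), v.valuation E x ≤ 1)
    (h : x * IsCMField.complexConj E x = 1) :
    ∃ u ∈ Units.torsion E, algebraMap (𝓞 E) E (u : 𝓞 E) = x := by
  have hxi : IsIntegral ℤ x := isIntegral_of_forall_valuation_le_one x hx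
  have hci : IsIntegral ℤ (IsCMField.complexConj E x) := by
    have := IsIntegral.map (LevelUnitsKroneckerCM.conjHom E).toIntAlgHom hxi
    simpa [LevelUnitsKroneckerCM.conjHom_apply] using this
  let y : 𝓞 E := ⟨x, hxi⟩
  let z : 𝓞 E := ⟨IsCMField.complexConj E x, hci⟩
  have hyz : y * z = 1 := by
    apply RingOfIntegers.coe_injective
    simp [y, z, h]
  refine ⟨⟨y, z, hyz, by rw [mul_comm]; exact hyz⟩, ?_, rfl⟩
  rw [Units.mem_torsion]
  intro w
  rw [← InfinitePlace.norm_embedding_eq]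
  exact LevelUnitsKroneckerCM.norm_embedding_eq_one_of_mul_complexConj_eq_one h _

/-- `E¹ ∩ ∏_v O_{E_v}` IS FINITE: the elements of a CM field with `x x̄ = 1` that are integral at
every finite place form a finite set (Mathlib's `NumberField.Embeddings.finite_of_norm_le`). -/
theorem finite_setOf_mul_complexConj_eq_one :
    {x : E | x * IsCMField.complexConj E x = 1 ∧
      ∀ v : HeightOneSpectrum (𝓞 E), v.valuation E x ≤ 1}.Finite := by
  refine (Embeddings.finite_of_norm_le E ℂ 1).subset ?_
  rintro x ⟨h, hx⟩
  exact ⟨isIntegral_of_forall_valuation_le_one x hx, fun φ =>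
    le_of_eq (LevelUnitsKroneckerCM.norm_embedding_eq_one_of_mul_complexConj_eq_one h φ)⟩

end CM

end Summit.Ventures.HodgeRepro2.LevelUnitsAdelicIntegral
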